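import Summits.ABC.IUTFork.Repair.CandExplicit4
import Summits.ABC.IUTFork.Repair.CandInternal2
import Summits.ABC.IUTFork.Cor312LogKummerRoute
import Summits.ABC.IUTFork.Cor312StatementBridge
import Summits.ABC.IUTFork.Cor312PinnedHonestInflationChannels
import Summits.ABC.IUTFork.Cor312LogKummerGlobal
import Summits.ABC.IUTFork.Repair.CandInternal41Profile
import Summits.ABC.IUTFork.Cor312LogKummerRoute2
import HarnessLib

/-!
# IUT REPAIR — cross-checker: the HONEST-VOLUME CEILING of the frame-blind region rows (abc-iut-rp-cx, XREAD-4 §2, N1 (d))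

Seat abc-iut-rp-cx, rung LADDER-ABC:A2.RP. Question N1 (d) of the evaluation recipe (HOME/plan/repair/cx/XREAD-3.md §0):
do the FRAME-BLIND region rows — RP-X04a `CandExplicit4.H` («q-pilot region ⊆ (Ind3)-enlarged Θ-region»), RP-I06
`CandInternal2.HQShellOrbit` («ρ(q-datum) ⊆ ⋃ₘ ρ(frobΨ m · 𝓘)»), RP-C01 `Cor312Vol.VolumeTransport` («−|log q| ≤ log-vol of SOME
Kummer image of the Θ-pilot», (xi-g) relaxed to `≤`) — admit a T-c witness obeying the WHOLE honesty checklist of REPAIR-SPEC v0.4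
(grade SAT+), in particular the clause «EXACT j²-scaling: logvol(thetaRegion3 j) = j² · qLocal j at every label j ∈ 𝔽_l^⋇» of
`Cor312Vol.RepairProtocol.satPlus_of_holds_at_flipSetting` together with «qLocal < 0»? Every ¬S witness of record violates exactly one
clause (LS(3): Θ-scaling; EXP(2,4): one q for all labels; SPH(2): Θ-scaling; GROW: KummerB — `Repair.EvalSphereProfile`,
`Repair.ModelGrowingColumn`).

ANSWER (kernel, this file): **NO such witness can exist.** The checklist's own clause `BridgeHyps P` carries MONOTONE log-volume on
admissible regions (`BridgeHyps.mono : Cor312Vol.LogvolMono P`, [IUTchIII] Prop. 3.9 (i)) and the admissibility of the possible images,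
among them `thetaRegion3` (`BridgeHyps.image_adm`, `Setting.thetaRegion3_mem_possibleImages`). At a label `j = i+1 ≥ 2` with `logvol(thetaRegion3 j) = j²·qLocal j`
and `qLocal j < 0` the (Ind3)-Θ-region has log-volume `j²·qLocal < qLocal` = the q-region's, so it cannot CONTAIN the q-region
(`x04_false_of_honest`), no single Kummer image `thetaRegion m ⊆ thetaRegion3` can have log-volume `≥ qLocal` (`volumeTransport_false_of_honest`),
and under the pin `QPinned` + RP-I05b `HInd3Theta` the log-shell orbit inclusion RP-I06 gives X04a, hence fails too
(`i06_false_of_honest`). The arithmetic core is `q < 0, j ≥ 2 ⇒ ¬ (q ≤ j²·q)` (`not_le_jsq_mul_of_neg`).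

READING (neutral; no side taken on [IUTchIII] Cor. 3.12 or on any author; candidates are hypotheses, never asserted; typed ≠ proved):
for these three rows the T-c ceiling is SAT⊖ BY THEOREM, not for lack of a bed — the same mechanism as BAR-R/BAR-S
(`Cor312PinnedCandidateProtocol.candidate_false_of_sufficient_of_scaledAt`) but needing neither `KummerB`, nor the pins, nor Step (x)
invariance: only `BridgeHyps` (monotonicity + admissibility), the exact-j² clause at ONE label `≥ 2` and a negative q-volume there —
all three are clauses of the SAT+ package, so «SAT+ for X04a / C01-VT / I06» is EMPTY whenever `2 ≤ l⋇` and a place exists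
(`no_satPlus_x04`, `no_satPlus_volumeTransport`, `no_satPlus_i06`). It does NOT touch the frame-SENSITIVE hull rows (X01b, M32c, M04b, I05∧I06-joint), whose SAT+ witnesses at `flipSetting` stand.
-/

namespace Summit.ABC.IUTFork.Repair.EvalHonestCeiling

open Thm311 Cor312 Cor312Vol

/-- Arithmetic core: a negative real is not `≤ j²` times itself for `j = i+1 ≥ 2`. [folklore] -/
theorem not_le_jsq_mul_of_neg {q : ℝ} (hq : q < 0) {i : ℕ} (hi : 1 ≤ i) : ¬ q ≤ ((i + 1 : ℕ) : ℝ) ^ 2 * q := by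
  intro h
  have h2 : (2 : ℝ) ≤ ((i + 1 : ℕ) : ℝ) := by exact_mod_cast (by omega : 2 ≤ i + 1)
  have h4 : (1 : ℝ) < ((i + 1 : ℕ) : ℝ) ^ 2 := by nlinarith
  have h5 := mul_lt_mul_of_neg_right h4 hq
  rw [one_mul] at h5
  exact absurd h (not_le.2 h5)

/-- `j² · q < q` for `q < 0`, `j = i+1 ≥ 2`. [folklore] -/
theorem jsq_mul_lt_of_neg {q : ℝ} (hq : q < 0) {i : ℕ} (hi : 1 ≤ i) : ((i + 1 : ℕ) : ℝ) ^ 2 * q < q :=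
  lt_of_not_ge (not_le_jsq_mul_of_neg hq hi)

variable {T : ThetaIndex} (S : LatticeSituation T) (P : Cor312.Setting S.toSituation)
  (ρ : (∀ v : T.V, v ∈ T.Vbad → Set (S.L.StarPacket v)) → ∀ (j : T.Label) (vQ : T.VQ), Set (S.L.Packet j vQ))
  (qK : ∀ v : T.V, v ∈ T.Vbad → Set (S.L.StarPacket v))

/-- **RP-X04a has no honest (SAT+) witness.** Monotone log-volume + admissible (Ind3)-Θ-region + exact j²-scaling at one label
`j = i+1 ≥ 2` + negative q-volume there ⟹ `¬ CandExplicit4.H` (the q-region, a hull-set hence admissible, would have log-volume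
`≤ j²·qLocal < qLocal` = its own). [folklore] -/
theorem x04_false_of_honest (hmono : LogvolMono P)
    (hθ : ∀ (j : T.Label) (vQ : T.VQ), (S.D P.n).Adm j vQ (P.thetaRegion3 j vQ))
    (i : Fin T.lstar) (hi : 1 ≤ (i : ℕ)) (vQ : T.VQ)
    (hscaled : (S.D P.n).logvol _ vQ (P.thetaRegion3 (Setting.labelSucc i) vQ) =
      (((i : ℕ) + 1 : ℕ) : ℝ) ^ 2 * P.qLocal (Setting.labelSucc i) vQ)
    (hneg : P.qLocal (Setting.labelSucc i) vQ < 0) :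
    ¬ CandExplicit4.H S P := fun h => by
  have h1 := hmono i vQ (P.hul_adm _ vQ _ (P.qRegion_mem _ vQ)) (hθ _ vQ) (h _ vQ)
  rw [hscaled] at h1
  exact not_le_jsq_mul_of_neg hneg hi h1

/-- **RP-C01 `VolumeTransport` has no honest (SAT+) witness.** Each Kummer image `thetaRegion m ⊆ thetaRegion3` (admissible,
`ThetaRegionsAdm`) has log-volume `≤ j²·qLocal < qLocal` at the scaled label, so no `m` realises `qLocal ≤ logvol(thetaRegion m)` there.
[folklore] -/
theorem volumeTransport_false_of_honest (hmono : LogvolMono P) (hadm : ThetaRegionsAdm P)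
    (hθ : ∀ (j : T.Label) (vQ : T.VQ), (S.D P.n).Adm j vQ (P.thetaRegion3 j vQ))
    (i : Fin T.lstar) (hi : 1 ≤ (i : ℕ)) (vQ : T.VQ)
    (hscaled : (S.D P.n).logvol _ vQ (P.thetaRegion3 (Setting.labelSucc i) vQ) =
      (((i : ℕ) + 1 : ℕ) : ℝ) ^ 2 * P.qLocal (Setting.labelSucc i) vQ)
    (hneg : P.qLocal (Setting.labelSucc i) vQ < 0) :
    ¬ VolumeTransport P := fun hvt => by
  obtain ⟨m, hm⟩ := hvt i vQ
  have h1 := hmono i vQ (hadm m i vQ) (hθ _ vQ) (Set.subset_iUnion (fun m : ℤ => P.thetaRegion m (Setting.labelSucc i) vQ) m)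
  rw [hscaled] at h1
  exact not_le_jsq_mul_of_neg hneg hi (hm.trans h1)

/-- **RP-I06 has no honest (SAT+) witness under the q-pin and RP-I05b.** With `QPinned` (q-region = ρ(q-datum)) and `HInd3Theta`
(each ρ(frobΨ m · 𝓘) inside the m-th Kummer image), `HQShellOrbit` gives X04a, which `x04_false_of_honest` excludes. [folklore] -/
theorem i06_false_of_honest (hq : QPinned S P ρ qK) (hA : CandInternal2.HInd3Theta S P ρ) (hmono : LogvolMono P)
    (hθ : ∀ (j : T.Label) (vQ : T.VQ), (S.D P.n).Adm j vQ (P.thetaRegion3 j vQ))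
    (i : Fin T.lstar) (hi : 1 ≤ (i : ℕ)) (vQ : T.VQ)
    (hscaled : (S.D P.n).logvol _ vQ (P.thetaRegion3 (Setting.labelSucc i) vQ) =
      (((i : ℕ) + 1 : ℕ) : ℝ) ^ 2 * P.qLocal (Setting.labelSucc i) vQ)
    (hneg : P.qLocal (Setting.labelSucc i) vQ < 0) :
    ¬ CandInternal2.HQShellOrbit S P ρ qK := fun hB =>
  x04_false_of_honest S P hmono hθ i hi vQ hscaled hneg fun j vQ x hx => by
    rw [hq] at hx
    obtain ⟨m, hm⟩ := Set.mem_iUnion.1 (hB j vQ hx)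
    exact Set.mem_iUnion.2 ⟨m, hA m j vQ hm⟩

/-- **X04a under `BridgeHyps` alone** (no separate admissibility hypothesis). [folklore] -/
theorem x04_false_of_bridgeHyps (hB : BridgeHyps P) (i : Fin T.lstar) (hi : 1 ≤ (i : ℕ)) (vQ : T.VQ)
    (hscaled : (S.D P.n).logvol _ vQ (P.thetaRegion3 (Setting.labelSucc i) vQ) =
      (((i : ℕ) + 1 : ℕ) : ℝ) ^ 2 * P.qLocal (Setting.labelSucc i) vQ)
    (hneg : P.qLocal (Setting.labelSucc i) vQ < 0) :
    ¬ CandExplicit4.H S P := fun h => by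
  have h1 := hB.mono i vQ (P.hul_adm _ vQ _ (P.qRegion_mem _ vQ)) (Cor312Vol.PinnedHonest.thetaRegion3_adm S P hB i vQ) (h _ vQ)
  rw [hscaled] at h1
  exact not_le_jsq_mul_of_neg hneg hi h1

/-- **C01-VT under `BridgeHyps` + `ThetaRegionsAdm`** (the latter is VT's own standing hypothesis in
`Cor312Vol.not_volumeTransport_of_not_statement`). [folklore] -/
theorem volumeTransport_false_of_bridgeHyps (hB : BridgeHyps P) (hadm : ThetaRegionsAdm P)
    (i : Fin T.lstar) (hi : 1 ≤ (i : ℕ)) (vQ : T.VQ)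
    (hscaled : (S.D P.n).logvol _ vQ (P.thetaRegion3 (Setting.labelSucc i) vQ) =
      (((i : ℕ) + 1 : ℕ) : ℝ) ^ 2 * P.qLocal (Setting.labelSucc i) vQ)
    (hneg : P.qLocal (Setting.labelSucc i) vQ < 0) :
    ¬ VolumeTransport P := fun hvt => by
  obtain ⟨m, hm⟩ := hvt i vQ
  have h1 := hB.mono i vQ (hadm m i vQ) (Cor312Vol.PinnedHonest.thetaRegion3_adm S P hB i vQ)
    (Set.subset_iUnion (fun m : ℤ => P.thetaRegion m (Setting.labelSucc i) vQ) m)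
  rw [hscaled] at h1
  exact not_le_jsq_mul_of_neg hneg hi (hm.trans h1)

/-- **SAT+ is EMPTY for RP-X04a**: with `2 ≤ l⋇` and one place `v_ℚ`, the SAT+ clauses `BridgeHyps`, «exact j²-scaling at every
label» and «qLocal < 0 at every label» already exclude `CandExplicit4.H` — whatever the model, frame, column or `ρ`. [folklore] -/
theorem no_satPlus_x04 (hl : 2 ≤ T.lstar) (vQ : T.VQ) (hB : BridgeHyps P)
    (hscaled : ∀ (i : Fin T.lstar) (vQ : T.VQ), (S.D P.n).logvol _ vQ (P.thetaRegion3 (Setting.labelSucc i) vQ) =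
      (((i : ℕ) + 1 : ℕ) : ℝ) ^ 2 * P.qLocal (Setting.labelSucc i) vQ)
    (hneg : ∀ (i : Fin T.lstar) (vQ : T.VQ), P.qLocal (Setting.labelSucc i) vQ < 0) :
    ¬ CandExplicit4.H S P :=
  x04_false_of_bridgeHyps S P hB ⟨1, hl⟩ le_rfl vQ (hscaled _ vQ) (hneg _ vQ)

/-- **SAT+ is EMPTY for RP-C01 `VolumeTransport`** (given its standing `ThetaRegionsAdm`). [folklore] -/
theorem no_satPlus_volumeTransport (hl : 2 ≤ T.lstar) (vQ : T.VQ) (hB : BridgeHyps P) (hadm : ThetaRegionsAdm P)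
    (hscaled : ∀ (i : Fin T.lstar) (vQ : T.VQ), (S.D P.n).logvol _ vQ (P.thetaRegion3 (Setting.labelSucc i) vQ) =
      (((i : ℕ) + 1 : ℕ) : ℝ) ^ 2 * P.qLocal (Setting.labelSucc i) vQ)
    (hneg : ∀ (i : Fin T.lstar) (vQ : T.VQ), P.qLocal (Setting.labelSucc i) vQ < 0) :
    ¬ VolumeTransport P :=
  volumeTransport_false_of_bridgeHyps S P hB hadm ⟨1, hl⟩ le_rfl vQ (hscaled _ vQ) (hneg _ vQ)

/-- **SAT+ is EMPTY for RP-I06 given the q-pin and RP-I05b.** [folklore] -/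
theorem no_satPlus_i06 (hl : 2 ≤ T.lstar) (vQ : T.VQ) (hB : BridgeHyps P) (hq : QPinned S P ρ qK)
    (hA : CandInternal2.HInd3Theta S P ρ)
    (hscaled : ∀ (i : Fin T.lstar) (vQ : T.VQ), (S.D P.n).logvol _ vQ (P.thetaRegion3 (Setting.labelSucc i) vQ) =
      (((i : ℕ) + 1 : ℕ) : ℝ) ^ 2 * P.qLocal (Setting.labelSucc i) vQ)
    (hneg : ∀ (i : Fin T.lstar) (vQ : T.VQ), P.qLocal (Setting.labelSucc i) vQ < 0) :
    ¬ CandInternal2.HQShellOrbit S P ρ qK := fun hB' =>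
  no_satPlus_x04 S P hl vQ hB hscaled hneg fun j vQ x hx => by
    rw [hq] at hx
    obtain ⟨m, hm⟩ := Set.mem_iUnion.1 (hB' j vQ hx)
    exact Set.mem_iUnion.2 ⟨m, hA m j vQ hm⟩

/-- **Package (N1 (d) of XREAD-3/4, kernel form).** On every model with monotone log-volume, admissible Θ-regions, exact j²-scaling
at one label `≥ 2` and negative q-volume there, the three frame-blind region rows X04a, C01-VT and (given the q-pin and I05b) I06 are
ALL false: their T-c ceiling is SAT⊖ by theorem. [folklore] -/
theorem frameBlind_rows_ceiling (hmono : LogvolMono P) (hadm : ThetaRegionsAdm P)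
    (hθ : ∀ (j : T.Label) (vQ : T.VQ), (S.D P.n).Adm j vQ (P.thetaRegion3 j vQ))
    (i : Fin T.lstar) (hi : 1 ≤ (i : ℕ)) (vQ : T.VQ)
    (hscaled : (S.D P.n).logvol _ vQ (P.thetaRegion3 (Setting.labelSucc i) vQ) =
      (((i : ℕ) + 1 : ℕ) : ℝ) ^ 2 * P.qLocal (Setting.labelSucc i) vQ)
    (hneg : P.qLocal (Setting.labelSucc i) vQ < 0) :
    ¬ CandExplicit4.H S P ∧ ¬ VolumeTransport P ∧
      (QPinned S P ρ qK → CandInternal2.HInd3Theta S P ρ → ¬ CandInternal2.HQShellOrbit S P ρ qK) :=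
  ⟨x04_false_of_honest S P hmono hθ i hi vQ hscaled hneg,
    volumeTransport_false_of_honest S P hmono hadm hθ i hi vQ hscaled hneg,
    fun hq hA => i06_false_of_honest S P ρ qK hq hA hmono hθ i hi vQ hscaled hneg⟩

/-! ## v2 APPEND (abc-iut-rp-cx, 08:55Z re-stage): the GLOBAL form RP-C01-GVT is excluded too -/

section GVT

open Literature.IUT.LogThetaLattice

/-- **RP-C01-GVT `GlobalVolumeTransport` has no honest (SAT+) witness.** Label by label, every choice of Kummer images has
`∑ᶠ_v logvol(thetaRegion (m i v)) ≤ j²·∑ᶠ_v qLocal = j²·(−|log q|)` (monotonicity inside the admissible `thetaRegion3`, exact j², one q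
for all labels), so the procession-normalised bound reads `−|log q| ≤ PN(j²)·(−|log q|)`, impossible for `−|log q| < 0`, `PN(j²) ≥ 5/2`.
[folklore] -/
theorem globalVolumeTransport_false_of_bridgeHyps (hB : BridgeHyps P) (hadm : ThetaRegionsAdm P)
    (hscaled : ∀ (i : Fin T.lstar) (vQ : T.VQ), (S.D P.n).logvol _ vQ (P.thetaRegion3 (Setting.labelSucc i) vQ) =
      (((i : ℕ) + 1 : ℕ) : ℝ) ^ 2 * P.qLocal (Setting.labelSucc i) vQ)
    (hindep : ∀ (i i' : Fin T.lstar) (vQ : T.VQ), P.qLocal (Setting.labelSucc i) vQ = P.qLocal (Setting.labelSucc i') vQ)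
    (hq : P.AbsLogQPos) : ¬ GlobalVolumeTransport P := by
  rintro ⟨m, hfin, hle⟩
  have hneg : P.negLogQ < 0 := hq
  have hPN := CandInternal41Profile.five_halves_le_PN_labelSq (T := T)
  have hterm : ∀ i : Fin T.lstar,
      ∑ᶠ vQ : T.VQ, (S.D P.n).logvol (Setting.labelSucc i) vQ (P.thetaRegion (m i vQ) (Setting.labelSucc i) vQ) ≤
        (((i : ℕ) + 1 : ℕ) : ℝ) ^ 2 * P.negLogQ := fun i => by
    rw [← PinnedHonest.finsum_qLocal_eq_negLogQ S P hindep i,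
      mul_finsum' _ _ (qLocal_support_finite (P := P) (Setting.labelSucc i))]
    refine finsum_le_finsum' (hfin i)
      ((qLocal_support_finite (P := P) (Setting.labelSucc i)).subset (Function.support_mul_subset_right _ _)) fun vQ => ?_
    have h1 := hB.mono i vQ (hadm (m i vQ) i vQ) (Cor312Vol.PinnedHonest.thetaRegion3_adm S P hB i vQ)
      (Set.subset_iUnion (fun m : ℤ => P.thetaRegion m (Setting.labelSucc i) vQ) (m i vQ))
    rw [hscaled] at h1
    exact h1
  have h2 : processionNormalized (fun i : Fin T.lstar =>
      ∑ᶠ vQ : T.VQ, (S.D P.n).logvol (Setting.labelSucc i) vQ (P.thetaRegion (m i vQ) (Setting.labelSucc i) vQ)) ≤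
      processionNormalized (fun i : Fin T.lstar => (((i : ℕ) + 1 : ℕ) : ℝ) ^ 2) * P.negLogQ := by
    refine (processionNormalized_mono hterm).trans_eq ?_
    unfold processionNormalized
    rw [← Finset.sum_mul, div_mul_eq_mul_div]
  have h4 := mul_lt_mul_of_neg_right
    (show (1 : ℝ) < processionNormalized (fun i : Fin T.lstar => (((i : ℕ) + 1 : ℕ) : ℝ) ^ 2) by linarith) hneg
  rw [one_mul] at h4
  exact absurd (hle.trans h2) (not_le.2 h4)

end GVT

/-! ## v3 APPEND (abc-iut-rp-cx, 09:00Z): the Frobenius-like form RP-C01-QFC is excluded too, under (ii)(a) `KummerA` of the typed Thm. 3.11 -/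

section QFC

/-- **RP-C01-QFC `QFrobComparison` under (ii)(a) `KummerA`**: the Frobenius-like log-volumes of the admissible q-region and Kummer
image ARE their mono-analytic log-volumes, so QFC is the VT inequality at some `m`, excluded as above. [folklore] -/
theorem qFrobComparison_false_of_kummerA (hKumA : (S.col P.n).KummerA (S.D P.n)) (hB : BridgeHyps P)
    (hadm : ThetaRegionsAdm P) (i : Fin T.lstar) (hi : 1 ≤ (i : ℕ)) (vQ : T.VQ)
    (hscaled : (S.D P.n).logvol _ vQ (P.thetaRegion3 (Setting.labelSucc i) vQ) =
      (((i : ℕ) + 1 : ℕ) : ℝ) ^ 2 * P.qLocal (Setting.labelSucc i) vQ)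
    (hneg : P.qLocal (Setting.labelSucc i) vQ < 0) :
    ¬ QFrobComparison P := fun h => by
  obtain ⟨m, hm⟩ := h i vQ
  have hqA : (S.D P.n).Adm _ vQ (P.qRegion (Setting.labelSucc i) vQ) := P.hul_adm _ vQ _ (P.qRegion_mem _ vQ)
  rw [(hKumA m _ vQ _ hqA).2, (hKumA m _ vQ _ (hadm m i vQ)).2] at hm
  have h1 := hB.mono i vQ (hadm m i vQ) (Cor312Vol.PinnedHonest.thetaRegion3_adm S P hB i vQ)
    (Set.subset_iUnion (fun m : ℤ => P.thetaRegion m (Setting.labelSucc i) vQ) m)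
  rw [hscaled] at h1
  exact not_le_jsq_mul_of_neg hneg hi (hm.trans h1)

/-- **SAT+ is EMPTY for RP-C01-QFC**: the package's `F.Statement` (typed Thm. 3.11 over a `FullSituation`) carries (ii)(a) `KummerA`
at column `n`; `2 ≤ l⋇` is part of `ThetaIndex`. So all three conjunct-candidates of row RP-C01 (VT, GVT, QFC) and the region rows
X04a / I06 have an EMPTY SAT+ class: their T-c ceiling is SAT⊖ by theorem. [folklore] -/
theorem no_satPlus_qFrobComparison (F : FullSituation T) (P : Cor312.Setting F.toLatticeSituation.toSituation) (vQ : T.VQ)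
    (hSt : F.Statement) (hB : BridgeHyps P) (hadm : ThetaRegionsAdm P)
    (hscaled : ∀ (i : Fin T.lstar) (vQ : T.VQ), (F.D P.n).logvol _ vQ (P.thetaRegion3 (Setting.labelSucc i) vQ) =
      (((i : ℕ) + 1 : ℕ) : ℝ) ^ 2 * P.qLocal (Setting.labelSucc i) vQ)
    (hneg : ∀ (i : Fin T.lstar) (vQ : T.VQ), P.qLocal (Setting.labelSucc i) vQ < 0) :
    ¬ QFrobComparison P :=
  qFrobComparison_false_of_kummerA F.toLatticeSituation P (hSt.2.1 P.n).1 hB hadm ⟨1, T.two_le_lstar⟩ le_rfl vQ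
    (hscaled _ vQ) (hneg _ vQ)

end QFC

end Summit.ABC.IUTFork.Repair.EvalHonestCeiling
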